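import Summits.AtomisticToContinuum.Crystallization.Theorems.ChargedEnergyGapCoolGuardDial
import Summits.AtomisticToContinuum.Crystallization.Theorems.OverbindingBudgetEnergyLayerTail
import Summits.AtomisticToContinuum.Crystallization.Theorems.PhononSlackCertificatesNearFarGlueRExtremeLayer
import Summits.AtomisticToContinuum.Crystallization.Theorems.PerronTransitivityUniformBindingRigidityCohesionL
import HarnessLib

/-!
# `ChargedEnergyGap` — COOL SEPARATION: a cool configuration is `3/5`-separated, so the free guard upgrades to `s = 3/5`
# (cell `decomp-a2c`, lens 3, generation 49, node «NeighbourhoodLedger», part L-A; over parts K-A / K-B)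

Part K-A (`…CoolGuard.chargedEnergyGap_iff_guardedPricing`) translates the crux into the pricing of `ε`-COOL,
`s`-SEPARATED periodic configurations for `s ≤ 1/3`: a particle of a closest pair at distance `r < 1/3` has site
energy `≥ 1 + r⁻³` (`ChargedEnergyGapGrossSurgery.le_siteEnergy_of_closest`), hence is hot and deletes itself.  This
file pushes the closest-pair argument to `r < 3/5` (generation 48 memo §7 (2), «do it first: it upgrades the free guard»):

§1 `le_siteEnergy_of_closest_of_sep` — THE ENGINE (every `0 < δ ≤ r < R`): a particle `i₀` of a closest pair at distance
   `r` of an injective configuration has site energy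
   `≥ V(r) − (1/12)·((2R/δ + 1)³ − 2) − (1/6)·T(δ, R)`,  `T(δ, R) = 16/(δ³R³) + 18/(δ²R⁴) + 36/(5δR⁵) + 1/R⁶`:
   the partner contributes `V(r)`; every other site within `R` contributes `≥ −1/12` and there are at most
   `(2R/δ + 1)³ − 2` of them (the whole configuration is `r ≥ δ`-separated; packing `card_le_of_separated_of_dist_le`
   counts `i₀` and the partner too); the sites beyond `R` contribute `≥ −(1/6)·Σ d⁻⁶ ≥ −(1/6)·T(δ, R)` (the tree's SHARP
   layer-cake tail `PerronTransitivityUniformBindingRigidity.sum_inv_pow_six_le_sharp`).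
§2 `one_le_siteEnergy_of_closest` — for `1/3 ≤ r < 3/5` that particle has site energy `≥ 1`, in three regimes with
   `R = 6/5`: `r < 1/2` (`δ = 1/3`: `V(1/2) = 330.67 ≥ 1 + 45.79 + 56.19`), `r < 11/20` (`δ = 1/2`: `V(11/20) = 102.74 ≥
   1 + 16.10 + 19.16`), `r < 3/5` (`δ = 11/20`: `V(3/5) = 34.71 ≥ 1 + 12.70 + 15.00`) — exact rational arithmetic
   (`norm_num`), `V` decreasing on `(0, 1]`.  (The crude shell sum `250·δ⁻⁶` of the `1/3`-argument is `≫ V(3/5)`; the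
   near/far split at `6/5` with the sharp tail is what closes.)
§3 ★ `exists_hotSite_of_dist_lt_threeFifths` — two sites closer than `3/5` ⟹ an `ε`-hot site (`e* + ε ≤ 1`); hence the
   deletion induction and ★★ THE TRANSLATION AT `s ≤ 3/5`: `chargedEnergyGap_iff_guardedPricing'`
   (`ChargedEnergyGap ↔ ∃ κ > 0, GuardedPricing ε s κ`, every `0 < ε`, `e* + ε ≤ 0`, `s ≤ 3/5`, given `ChargeRecount`),
   record `(ε, s) = (1/10, 3/5)`; and part K-B's guarded chart dial at `s ≤ 3/5` (`chargedEnergyGap_iff_piecesG'`).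
   CONSEQUENTLY every `∀ Q`-piece of the lineage may assume `Guard (1/10) (3/5) Q` — no rattlers AND hard cores of
   diameter `3/5` — for free (the packing constants of part L-C drop from `(2ρ₀·3 + 1)³` to `(2ρ₀·5/3 + 1)³`).
   Periodic reading (not needed below, not proved here): a guarded `Q` is automatically `3/5`-separated.

All `[this work]` = cell decomp-a2c lens 3; ingredients `[folklore]` from the tree as named.
-/

noncomputable section

open scoped BigOperators
open Literature.MathematicalPhysics.StatisticalMechanics
open Literature.Geometry.DiscreteGeometry
open Summit.AtomisticToContinuum.Crystallization.Theses.PricedLinkCensus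
open Summit.AtomisticToContinuum.Crystallization.Theorems.ChargedEnergyGapNegative
open Summit.AtomisticToContinuum.Crystallization.Theorems.PerronTransitivityUniformBindingRigidity
  (sum_inv_pow_six_le_sharp)

namespace Summit.AtomisticToContinuum.Crystallization.Theorems.ChargedEnergyGapChartDial

/-! ## §1 The engine: site energy of a closest-pair particle, near/far split with the sharp tail -/

section Engine

variable {N : ℕ}

-- `lennardJones_anti_of_le_one` / `neg_inv_pow_six_le_lennardJones` are already landed (gate dedup):
-- `…PhononSlackCertificatesNearFarGlueR.lennardJones_le_of_le_one` and `…OverbindingBudgetEnergyLayerTail.lennardJones_ge_neg` are used instead.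

/-- ★ **THE ENGINE.**  In an injective configuration whose closest pair `(i₀, j₀)` is at distance `r`, for every
`0 < δ ≤ r < R`:  `V(r) − (1/12)((2R/δ + 1)³ − 2) − (1/6)·T(δ, R) ≤ siteEnergy(i₀)` (partner `V(r)`; the other sites
within `R`: `≥ −1/12` each, at most `(2R/δ+1)³ − 2` of them by packing; beyond `R`: the sharp sixth-power tail). -/
theorem le_siteEnergy_of_closest_of_sep {y : Fin N → E3} (hy : Function.Injective y) {i₀ j₀ : Fin N} (hij₀ : i₀ ≠ j₀)
    (hmin : ∀ a b : Fin N, a ≠ b → dist (y i₀) (y j₀) ≤ dist (y a) (y b)) {δ R : ℝ} (hδ : 0 < δ)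
    (hδr : δ ≤ dist (y i₀) (y j₀)) (hrR : dist (y i₀) (y j₀) < R) :
    lennardJones (dist (y i₀) (y j₀)) - 1 / 12 * ((2 * R / δ + 1) ^ 3 - 2) -
        1 / 6 * (16 / (δ ^ 3 * R ^ 3) + 18 / (δ ^ 2 * R ^ 4) + 36 / (5 * δ * R ^ 5) + 1 / R ^ 6) ≤
      Literature.MathematicalPhysics.StatisticalMechanics.siteEnergy lennardJones y i₀ := by
  classical
  have hR : 0 < R := lt_of_le_of_lt dist_nonneg hrR
  have hsep : ∀ a b : Fin N, a ≠ b → δ ≤ dist (y a) (y b) := fun a b hab => hδr.trans (hmin a b hab)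
  have hsepY : ∀ p ∈ Set.range y, ∀ q ∈ Set.range y, p ≠ q → δ ≤ dist p q := by
    rintro _ ⟨a, rfl⟩ _ ⟨b, rfl⟩ hne
    exact hsep a b fun h => hne (congrArg y h)
  set S := Finset.univ.erase i₀ with hS
  -- pointwise lower bound by three indicator terms
  have key : ∀ a ∈ S,
      (if a = j₀ then lennardJones (dist (y i₀) (y j₀)) else 0) +
          (if dist (y i₀) (y a) < R ∧ a ≠ j₀ then -(1 / 12 : ℝ) else 0) +
          (if R ≤ dist (y i₀) (y a) then -(1 / 6 * (dist (y i₀) (y a))⁻¹ ^ 6) else 0) ≤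
        lennardJones (dist (y i₀) (y a)) := by
    intro a _
    by_cases hj : a = j₀
    · subst hj
      have h1 : ¬ (dist (y i₀) (y a) < R ∧ a ≠ a) := fun h => h.2 rfl
      have h2 : ¬ R ≤ dist (y i₀) (y a) := not_le.2 hrR
      rw [if_pos rfl, if_neg h1, if_neg h2, add_zero, add_zero]
    · by_cases hn : dist (y i₀) (y a) < R
      · have h1 : dist (y i₀) (y a) < R ∧ a ≠ j₀ := ⟨hn, hj⟩
        have h2 : ¬ R ≤ dist (y i₀) (y a) := not_le.2 hn
        rw [if_neg hj, if_pos h1, if_neg h2, zero_add, add_zero]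
        linarith [neg_one_div_le_lennardJones (dist (y i₀) (y a))]
      · have h1 : ¬ (dist (y i₀) (y a) < R ∧ a ≠ j₀) := fun h => hn h.1
        have h2 : R ≤ dist (y i₀) (y a) := not_lt.1 hn
        rw [if_neg hj, if_neg h1, if_pos h2, zero_add, zero_add]
        exact Summit.AtomisticToContinuum.Crystallization.Theorems.OverbindingBudgetEnergyLayerTail.lennardJones_ge_neg _
  have hsum := Finset.sum_le_sum key
  rw [Finset.sum_add_distrib, Finset.sum_add_distrib] at hsum
  -- the partner term
  have hT1 : (∑ a ∈ S, if a = j₀ then lennardJones (dist (y i₀) (y j₀)) else 0) = lennardJones (dist (y i₀) (y j₀)) := by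
    rw [Finset.sum_ite_eq' S j₀ (fun _ => lennardJones (dist (y i₀) (y j₀))), if_pos]
    exact Finset.mem_erase.2 ⟨hij₀.symm, Finset.mem_univ _⟩
  -- the near count
  set Near := S.filter fun a => dist (y i₀) (y a) < R ∧ a ≠ j₀ with hNear
  have hT2 : (∑ a ∈ S, if dist (y i₀) (y a) < R ∧ a ≠ j₀ then -(1 / 12 : ℝ) else 0) = -(1 / 12) * (Near.card : ℝ) := by
    rw [← Finset.sum_filter, Finset.sum_const, nsmul_eq_mul, mul_comm]
  have hNearCard : (Near.card : ℝ) + 2 ≤ (2 * R / δ + 1) ^ 3 := by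
    set B := Finset.univ.filter fun a : Fin N => dist (y i₀) (y a) ≤ R with hB
    have hsub : insert i₀ (insert j₀ Near) ⊆ B := by
      intro a ha
      rw [hB, Finset.mem_filter]
      refine ⟨Finset.mem_univ _, ?_⟩
      rcases Finset.mem_insert.1 ha with rfl | ha
      · rw [dist_self]; exact hR.le
      rcases Finset.mem_insert.1 ha with rfl | ha
      · exact hrR.le
      · exact ((Finset.mem_filter.1 ha).2.1).le
    have hj₀ : j₀ ∉ Near := fun h => (Finset.mem_filter.1 h).2.2 rfl
    have hi₀ : i₀ ∉ insert j₀ Near := by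
      intro h
      rcases Finset.mem_insert.1 h with h | h
      · exact hij₀ h
      · exact (Finset.mem_erase.1 (Finset.mem_filter.1 h).1).1 rfl
    have hcard3 : (insert i₀ (insert j₀ Near)).card = Near.card + 2 := by
      rw [Finset.card_insert_of_notMem hi₀, Finset.card_insert_of_notMem hj₀]
    have hle := Finset.card_le_card hsub
    rw [hcard3] at hle
    have himg : ((B.image y).card : ℝ) ≤ (2 * R / δ + 1) ^ Module.finrank ℝ E3 :=
      card_le_of_separated_of_dist_le (B.image y) (y i₀) hδ hR.le
        (fun c hc => by
          obtain ⟨a, ha, rfl⟩ := Finset.mem_image.1 hc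
          rw [dist_comm]; exact (Finset.mem_filter.1 ha).2)
        (fun c hc d hd hcd => by
          obtain ⟨a, -, rfl⟩ := Finset.mem_image.1 hc
          obtain ⟨b, -, rfl⟩ := Finset.mem_image.1 hd
          exact hsep a b fun h => hcd (congrArg y h))
    rw [finrank_euclideanSpace_fin, Finset.card_image_of_injective B hy] at himg
    have : ((Near.card + 2 : ℕ) : ℝ) ≤ (B.card : ℝ) := by exact_mod_cast hle
    push_cast at this
    linarith
  -- the far tail
  set Far := S.filter fun a => R ≤ dist (y i₀) (y a) with hFar
  have hT3 : (∑ a ∈ S, if R ≤ dist (y i₀) (y a) then -(1 / 6 * (dist (y i₀) (y a))⁻¹ ^ 6) else 0) =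
      -(1 / 6) * ∑ a ∈ Far, (dist (y i₀) (y a))⁻¹ ^ 6 := by
    rw [← Finset.sum_filter, Finset.mul_sum]
    refine Finset.sum_congr rfl fun a _ => by ring
  have hFarSum : ∑ a ∈ Far, (dist (y i₀) (y a))⁻¹ ^ 6 ≤
      16 / (δ ^ 3 * R ^ 3) + 18 / (δ ^ 2 * R ^ 4) + 36 / (5 * δ * R ^ 5) + 1 / R ^ 6 := by
    have h := sum_inv_pow_six_le_sharp hδ hsepY (y i₀) hR (Far.image y) fun q hq => by
      obtain ⟨a, ha, rfl⟩ := Finset.mem_image.1 hq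
      exact ⟨⟨a, rfl⟩, by rw [dist_comm]; exact (Finset.mem_filter.1 ha).2⟩
    rw [Finset.sum_image fun a _ b _ h => hy h] at h
    simpa only [dist_comm] using h
  unfold Literature.MathematicalPhysics.StatisticalMechanics.siteEnergy
  rw [hT1, hT2, hT3] at hsum
  nlinarith [hsum, hNearCard, hFarSum]

/-! ## §2 Closest pairs at distance `1/3 ≤ r < 3/5`: site energy `≥ 1`, three regimes -/

/-- ★ **A particle of a closest pair at distance `1/3 ≤ r < 3/5` has site energy `≥ 1`** (regimes `r < 1/2`, `r < 11/20`,
`r < 3/5` of the engine with `(δ, R) = (1/3, 6/5), (1/2, 6/5), (11/20, 6/5)`; margins `228`, `67`, `7`). -/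
theorem one_le_siteEnergy_of_closest {y : Fin N → E3} (hy : Function.Injective y) {i₀ j₀ : Fin N} (hij₀ : i₀ ≠ j₀)
    (hmin : ∀ a b : Fin N, a ≠ b → dist (y i₀) (y j₀) ≤ dist (y a) (y b)) (h3 : 1 / 3 ≤ dist (y i₀) (y j₀))
    (h5 : dist (y i₀) (y j₀) < 3 / 5) :
    1 ≤ Literature.MathematicalPhysics.StatisticalMechanics.siteEnergy lennardJones y i₀ := by
  have hr0 : 0 < dist (y i₀) (y j₀) := by linarith
  by_cases ha : dist (y i₀) (y j₀) < 1 / 2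
  · have h := le_siteEnergy_of_closest_of_sep hy hij₀ hmin (δ := 1 / 3) (R := 6 / 5) (by norm_num) h3 (by linarith)
    have hV : lennardJones (1 / 2) ≤ lennardJones (dist (y i₀) (y j₀)) :=
      Summit.AtomisticToContinuum.Crystallization.Theorems.PhononSlackCertificatesNearFarGlueR.lennardJones_le_of_le_one hr0 ha.le (by norm_num)
    have hnum : (1 : ℝ) + 1 / 12 * ((2 * (6 / 5) / (1 / 3) + 1) ^ 3 - 2) +
        1 / 6 * (16 / ((1 / 3) ^ 3 * (6 / 5) ^ 3) + 18 / ((1 / 3) ^ 2 * (6 / 5) ^ 4) + 36 / (5 * (1 / 3) * (6 / 5) ^ 5) +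
          1 / (6 / 5) ^ 6) ≤ lennardJones (1 / 2) := by
      norm_num [lennardJones]
    linarith
  by_cases hb : dist (y i₀) (y j₀) < 11 / 20
  · have h := le_siteEnergy_of_closest_of_sep hy hij₀ hmin (δ := 1 / 2) (R := 6 / 5) (by norm_num) (not_lt.1 ha)
      (by linarith)
    have hV : lennardJones (11 / 20) ≤ lennardJones (dist (y i₀) (y j₀)) :=
      Summit.AtomisticToContinuum.Crystallization.Theorems.PhononSlackCertificatesNearFarGlueR.lennardJones_le_of_le_one hr0 hb.le (by norm_num)
    have hnum : (1 : ℝ) + 1 / 12 * ((2 * (6 / 5) / (1 / 2) + 1) ^ 3 - 2) +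
        1 / 6 * (16 / ((1 / 2) ^ 3 * (6 / 5) ^ 3) + 18 / ((1 / 2) ^ 2 * (6 / 5) ^ 4) + 36 / (5 * (1 / 2) * (6 / 5) ^ 5) +
          1 / (6 / 5) ^ 6) ≤ lennardJones (11 / 20) := by
      norm_num [lennardJones]
    linarith
  · have h := le_siteEnergy_of_closest_of_sep hy hij₀ hmin (δ := 11 / 20) (R := 6 / 5) (by norm_num) (not_lt.1 hb)
      (by linarith)
    have hV : lennardJones (3 / 5) ≤ lennardJones (dist (y i₀) (y j₀)) :=
      Summit.AtomisticToContinuum.Crystallization.Theorems.PhononSlackCertificatesNearFarGlueR.lennardJones_le_of_le_one hr0 h5.le (by norm_num)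
    have hnum : (1 : ℝ) + 1 / 12 * ((2 * (6 / 5) / (11 / 20) + 1) ^ 3 - 2) +
        1 / 6 * (16 / ((11 / 20) ^ 3 * (6 / 5) ^ 3) + 18 / ((11 / 20) ^ 2 * (6 / 5) ^ 4) +
          36 / (5 * (11 / 20) * (6 / 5) ^ 5) + 1 / (6 / 5) ^ 6) ≤ lennardJones (3 / 5) := by
      norm_num [lennardJones]
    linarith

/-! ## §3 Hot sites at `3/5`; the deletion induction and the translation at `s ≤ 3/5` -/

/-- ★ **Two sites closer than `3/5` ⟹ an `ε`-hot site** (`e* + ε ≤ 1`): a particle of a closest pair, of site energy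
`≥ 1 + r⁻³` if `r < 1/3` (part K-A's lemma) and `≥ 1` if `1/3 ≤ r < 3/5` (§2). -/
theorem exists_hotSite_of_dist_lt_threeFifths {ε : ℝ} (hε1 : eStar + ε ≤ 1) {y : Fin N → E3} (hy : Function.Injective y)
    {i k : Fin N} (hki : k ≠ i) (hik : dist (y i) (y k) < 3 / 5) : ∃ i₀, HotSite ε y i₀ := by
  classical
  obtain ⟨p, hp, hmin⟩ := Finset.exists_min_image Finset.univ.offDiag
    (fun p : Fin N × Fin N => dist (y p.1) (y p.2)) ⟨(i, k), by simp [hki.symm]⟩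
  obtain ⟨i₀, j₀⟩ := p
  have hij₀ : i₀ ≠ j₀ := by simpa using hp
  have hsep : ∀ a b : Fin N, a ≠ b → dist (y i₀) (y j₀) ≤ dist (y a) (y b) :=
    fun a b hab => hmin (a, b) (by simp [hab])
  have hr5 : dist (y i₀) (y j₀) < 3 / 5 := (hsep i k hki.symm).trans_lt hik
  refine ⟨i₀, ?_⟩
  unfold HotSite
  by_cases hr3 : dist (y i₀) (y j₀) < 1 / 3
  · have hu := ChargedEnergyGapGrossSurgery.le_siteEnergy_of_closest hy hij₀ hsep hr3
    have h3 : (0 : ℝ) ≤ (dist (y i₀) (y j₀))⁻¹ ^ 3 := by positivity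
    linarith
  · linarith [one_le_siteEnergy_of_closest hy hij₀ hsep (not_lt.1 hr3) hr5]

/-- A configuration that is not cool-and-`s`-separated (`s ≤ 3/5`, `e* + ε ≤ 1`) has an `ε`-hot site. -/
theorem exists_hotSite_of_not_coolSep_threeFifths {ε s : ℝ} (hs : s ≤ 3 / 5) (hε1 : eStar + ε ≤ 1) {y : Fin N → E3}
    (hy : Function.Injective y) (h : ¬ CoolSep ε s y) : ∃ i₀, HotSite ε y i₀ := by
  by_contra hno
  push Not at hno
  apply h
  refine ⟨hno, fun i j hij => ?_⟩
  by_contra hlt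
  push Not at hlt
  obtain ⟨i₀, hi₀⟩ := exists_hotSite_of_dist_lt_threeFifths hε1 hy (Ne.symm hij) (lt_of_lt_of_le hlt hs)
  exact hno i₀ hi₀

/-- ★ **HOT SITES DELETE THEMSELVES, up to separation `3/5`**: part K-A's `noBoundary_of_coolSepPricing` with `s ≤ 3/5`
(same induction, the `3/5` hot-site lemma in place of the `1/3` one). -/
theorem noBoundary_of_coolSepPricing_threeFifths (hF : ChargeRecount) {ε s κ₁ : ℝ} (hε : 0 < ε) (hε0 : eStar + ε ≤ 0)
    (hs : s ≤ 3 / 5) (hκ₁ : 0 < κ₁)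
    (h : ∀ (N : ℕ) (y : Fin N → E3), Function.Injective y → CoolSep ε s y →
      (N : ℝ) * eStar + κ₁ * (charged (1 / 100) y : ℝ) ≤ interactionEnergy lennardJones y) :
    ∃ κ : ℝ, 0 < κ ∧ NoBoundary (1 / 100) κ := by
  obtain ⟨F, hF⟩ := hF
  have hεB : eStar + ε ≤ 1 := hε0.trans (by norm_num)
  set κ := min κ₁ (ε / ((F : ℝ) + 1)) with hκdef
  have hκpos : 0 < κ := lt_min hκ₁ (by positivity)
  have hκle : κ ≤ κ₁ := min_le_left _ _
  have hκF : κ * (F : ℝ) ≤ ε := by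
    calc κ * (F : ℝ) ≤ ε / ((F : ℝ) + 1) * ((F : ℝ) + 1) :=
          mul_le_mul (min_le_right _ _) (by linarith) (Nat.cast_nonneg _) (by positivity)
      _ = ε := div_mul_cancel₀ _ (by positivity)
  refine ⟨κ, hκpos, ?_⟩
  intro N
  induction N with
  | zero =>
    intro y hy
    exact gap_of_gap_of_le hκle (h 0 y hy ⟨fun i => i.elim0, fun i => i.elim0⟩)
  | succ n ih =>
    intro y hy
    by_cases hc : CoolSep ε s y
    · exact gap_of_gap_of_le hκle (h (n + 1) y hy hc)
    obtain ⟨i₀, hi₀⟩ := exists_hotSite_of_not_coolSep_threeFifths hs hεB hy hc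
    have hy' : Function.Injective (y ∘ i₀.succAbove) := hy.comp Fin.succAbove_right_injective
    have hE : interactionEnergy lennardJones y =
        interactionEnergy lennardJones (y ∘ i₀.succAbove) +
          Literature.MathematicalPhysics.StatisticalMechanics.siteEnergy lennardJones y i₀ :=
      interactionEnergy_eq_succAbove_add_siteEnergy lennardJones lennardJones_zero y i₀
    have hih := ih (y ∘ i₀.succAbove) hy'
    have hDR : (charged (1 / 100) y : ℝ) ≤ (charged (1 / 100) (y ∘ i₀.succAbove) : ℝ) + F := by
      have := hF n y i₀ hy
      unfold charged
      exact_mod_cast this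
    have hhot : eStar + ε ≤ Literature.MathematicalPhysics.StatisticalMechanics.siteEnergy lennardJones y i₀ := hi₀
    rw [Nat.cast_succ, hE]
    have hκD : κ * (charged (1 / 100) y : ℝ) ≤ κ * (charged (1 / 100) (y ∘ i₀.succAbove) : ℝ) + κ * F := by
      nlinarith [hκpos.le]
    linarith

end Engine

/-! ## §4 ★★ The translation and the guarded chart dial at `s ≤ 3/5` -/

section Translation

/-- ★★ **`ChargedEnergyGap ↔ ∃ κ > 0, GuardedPricing ε s κ` for every `0 < ε` with `e* + ε ≤ 0` and every `s ≤ 3/5`**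
(given `ChargeRecount`): pricing charge on `ε`-cool periodic configurations with HARD CORES OF DIAMETER `3/5` is the whole
crux. -/
theorem chargedEnergyGap_iff_guardedPricing' (hF : ChargeRecount) {ε s : ℝ} (hε : 0 < ε) (hε0 : eStar + ε ≤ 0)
    (hs : s ≤ 3 / 5) : ChargedEnergyGap ↔ ∃ κ : ℝ, 0 < κ ∧ GuardedPricing ε s κ := by
  constructor
  · intro hC
    obtain ⟨κ, hκ, hp⟩ := chargedEnergyGap_iff_periodicPricing.1 hC
    exact ⟨κ, hκ, guardedPricing_of_periodicPricing hp⟩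
  · rintro ⟨κ₁, hκ₁, h⟩
    obtain ⟨κ, hκ, hNB⟩ := noBoundary_of_coolSepPricing_threeFifths hF hε hε0 hs hκ₁
      (coolSepPricing_of_guardedPricing hε0 (hs.trans (by norm_num)) h)
    exact chargedEnergyGap_iff_noBoundary.2 ⟨κ, hκ, hNB⟩

/-- ★★ **RECORD** `(ε, s) = (1/10, 3/5)`: `ChargedEnergyGap ↔ ∃ κ > 0, GuardedPricing (1/10) (3/5) κ` (given `ChargeRecount`). -/
theorem chargedEnergyGap_iff_guardedPricing_record35 (hF : ChargeRecount) :
    ChargedEnergyGap ↔ ∃ κ : ℝ, 0 < κ ∧ GuardedPricing (1 / 10) (3 / 5) κ :=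
  chargedEnergyGap_iff_guardedPricing' hF (by norm_num) eStar_add_tenth_nonpos le_rfl

/-- Hence the two guarded pricings are equivalent: demanding `3/5`-hard cores costs nothing over `1/3` (`0 < ε`,
`e* + ε ≤ 0`, `s ≤ 1/3`, `s' ≤ 3/5`; given `ChargeRecount`). -/
theorem guardedPricing_iff_guardedPricing (hF : ChargeRecount) {ε s s' : ℝ} (hε : 0 < ε) (hε0 : eStar + ε ≤ 0)
    (hs : s ≤ 1 / 3) (hs' : s' ≤ 3 / 5) :
    (∃ κ : ℝ, 0 < κ ∧ GuardedPricing ε s κ) ↔ ∃ κ : ℝ, 0 < κ ∧ GuardedPricing ε s' κ := by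
  rw [← chargedEnergyGap_iff_guardedPricing hF hε hε0 hs, chargedEnergyGap_iff_guardedPricing' hF hε hε0 hs']

/-- **`closes` of part K-B's guarded dial at `s ≤ 3/5`**: the two guarded pieces imply the crux. -/
theorem chargedEnergyGap_of_piecesG' (hF : ChargeRecount) {θ ε s : ℝ} (hε : 0 < ε) (hε0 : eStar + ε ≤ 0)
    (hs : s ≤ 3 / 5) (hG : GrossChargeGapG θ ε s) (hP : ChartedChargePricingG θ ε s) : ChargedEnergyGap :=
  (chargedEnergyGap_iff_guardedPricing' hF hε hε0 hs).2 (guardedPricing_of_piecesG hG hP)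

/-- ★★ **Part K-B's guarded node at `s ≤ 3/5`**: `ChargedEnergyGap ↔ GrossChargeGapG θ ε s ∧ ChartedChargePricingG θ ε s`
for every `θ`, every `0 < ε` with `e* + ε ≤ 0` and every `s ≤ 3/5` (given `ChargeRecount`). -/
theorem chargedEnergyGap_iff_piecesG' (hF : ChargeRecount) {θ ε s : ℝ} (hε : 0 < ε) (hε0 : eStar + ε ≤ 0)
    (hs : s ≤ 3 / 5) : ChargedEnergyGap ↔ GrossChargeGapG θ ε s ∧ ChartedChargePricingG θ ε s :=
  ⟨fun h => ⟨grossChargeGapG_of_chargedEnergyGap θ ε s h, chartedChargePricingG_of_chargedEnergyGap θ ε s h⟩,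
    fun h => chargedEnergyGap_of_piecesG' hF hε hε0 hs h.1 h.2⟩

/-- ★★ **RECORD** `(θ, ε, s) = (3/20, 1/10, 3/5)`: `ChargedEnergyGap ↔ GrossChargeGapG (3/20) (1/10) (3/5) ∧
ChartedChargePricingG (3/20) (1/10) (3/5)` (given `ChargeRecount`). -/
theorem chargedEnergyGap_iff_piecesG_record35 (hF : ChargeRecount) :
    ChargedEnergyGap ↔ GrossChargeGapG (3 / 20) (1 / 10) (3 / 5) ∧ ChartedChargePricingG (3 / 20) (1 / 10) (3 / 5) :=
  chargedEnergyGap_iff_piecesG' hF (by norm_num) eStar_add_tenth_nonpos le_rfl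

end Translation

end Summit.AtomisticToContinuum.Crystallization.Theorems.ChargedEnergyGapChartDial

end
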